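import Literature.MathematicalPhysics.QuantumFieldTheory.Balaban1983to89.Node00.OpsYSectDE

/-!
# `Balaban1983to89.B9Eq3132AtRecordDE` — T. Bałaban, *Propagators for lattice gauge theories in a background field*, Commun. Math. Phys. **99** (1985)
# 389–434 [Balaban1985BackgroundPropagators], (3.132) p. 422: ROW 26 OF THE N06 TABLE AT def-Y's v3 RECORD `opsYOfRecordDE` — BOTH LETTERS `(QGQ*)⁻¹`,
# `(QG₁Q*)⁻¹` GENUINE — FROM EXACTLY FOUR ESTIMATE BINDERS

statement-level skeleton of published theorems with citation tags; proofs where landed; nothing here is a claim about the Yang–Mills mass gap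

THE PRINT (p. 422 [PDF 34]): *«|(QGQ*)⁻¹(U; y, y′)| ≤ O(1)(L^jη)^{−1−d/2}(L^{j′}η)^{−1−d/2} e^{−δ₁d(y,y′)} (3.132) … and the same for the operator with G₁
instead of G»* (introduced before Thm 3.12; Thm 3.13 p. 426 is stated «assuming (3.132)»).  p. 420: *«G⁻¹ = Δ_π + DRD* + Q*aQ»* (3.122), *«ω = (QGQ*)⁻¹B»*
(3.123); p. 421: (3.128)–(3.129) (`G₁`, `H₁ = G₁Q*(QG₁Q*)⁻¹`).

WHY THIS FILE (dag-n06-i = bundle F4, rows 14·25·26; row 26 = `s3132 : B9.Stmt3132Printed … (ops x).QGQinv (ops x).QG1Qinv`).  def-Y's FILE 7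
`Node00.OpsYSectDE` (p492998) landed the v3 record `lettersYOfRecordDE N θ M⋆ 𝔯` ∕ `opsYOfRecordDE N θ M⋆ 𝔯 𝔈` in which BOTH (3.132) letters are
genuine `Ring.inverse`s: `(QGQ*)⁻¹` over Sect. D's `G = GDY` (n06-i g5's `QGQinvY`, `B9Eq3132SectDLetters`) and `(QG₁Q*)⁻¹ = QGQinvOfY parB (G1Y … Δ2)`
over the residual letter `Δ⁽²⁾` (def-Y).  Its CONSUMER NOTE names the S-sized corollary this file proves: row 26 at that record from the four estimate
binders and nothing else — g5's `s3132_withSectD` at `𝔏 := lettersYResOfRecord … 𝔯` (`lettersYOfRecordDE_eq_withSectD`, `rfl`) with the `(QG₁Q*)⁻¹` half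
from g4's ring-inverse dictionary (`half3132_geo9Y_of_ringInverse`).

WHAT IS PROVED (sorry-free; 0 def).  `opsYOfRecordDE_QGQinv ∕ _QG1Qinv` (the two readings at the record are `siteKernelOfOp … (U ↦ Ring.inverse (T U)) id id`
for the named operators `T = QGQY …` ∕ `QGQOfY parBY (G1Y …)`, `rfl`); ★★ `s3132_opsYOfRecordDE N θ M⋆ 𝔯 𝔈 dd b hco hdec hco₁ hdec₁ : B9.Stmt3132Printed dd c35
geo9Y (bg9Y …) (x ↦ (opsYOfRecordDE … x).QGQinv) (x ↦ (opsYOfRecordDE … x).QG1Qinv)` from Thm 3.11-type COERCIVITY and Thm 3.3-type DECAY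
(`B9Eq3132CTInputs.CoerciveUnder ∕ DecayUnder`) of the normalised real matrices (`B9Eq3132RingInverseReading.normMatY b w`, symmetric weights
`w(y) = (Lʲη)^{−(1+d′∕2)}`, any real basis `b` of `M_N(ℂ)`) of the genuine `(QGQ*)(U)` and `(QG₁Q*)(U)`.

HONEST SCOPE.  One composition of landed theorems; the four estimates are HYPOTHESES for good in this programme (print's route: «analyzed in the
same way as (Q′G′²Q′*)⁻¹», Sect. B — not typed); count-neutral; NOT a node discharge; nothing continuum ∕ OS ∕ mass-gap.  The same statement holds
verbatim at n06-i's instance `B9Ineq349SiteReading.opsYS349OfRecordDE` (its `QGQinv ∕ QG1Qinv` fields are these, `rfl`).  Filed by dag-n06-i gen 6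
(pub-ymgap N06 bundle F4); a NEW file; nothing landed is modified.
-/

namespace Literature.MathematicalPhysics.QuantumFieldTheory.Balaban1983to89.B9Eq3132AtRecordDE

open Node00
open B6KLevelCensusIndexV1 (KIdx)
open B9PinMembersKLevelV1 (MemberY geo9Y bg9Y)
open B9Eq3132CTInputs (CoerciveUnder DecayUnder)
open B9Eq3132ScalarIndex (geoComap)
open B9Eq3132RingInverseReading (normMatY)
open B9Eq3132SectDLetters (QGQY withSectD Half3132 s3132_withSectD half3132_geo9Y_of_ringInverse)
open B7Prop2SpecialUnitary (specialUnitaryUnits)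
open scoped Matrix

noncomputable section

section Row26

open scoped Matrix.Norms.L2Operator

variable {N : ℕ} {Ff : Type} [Fintype Ff] [DecidableEq Ff]

/-- the knit's `(QG₁Q*)⁻¹` reading at the v3 record reads `U ↦ Ring.inverse ((QG₁Q*)(U))` over `G₁ … (𝔯 x).Δ2` (`rfl`).
[cite: Balaban1985BackgroundPropagators, (3.132) p.422, (3.129) p.421, bookkeeping] -/
theorem opsYOfRecordDE_QG1Qinv (θ : Stage3Params) (Mstar : ℕ) (𝔯 : ResY N θ Mstar) (𝔈 : ExpsY N θ Mstar)
    (x : MemberY θ.d₆ θ.ℓ₆ θ.hd' θ.hL' θ.b₀ θ.b₁ Mstar) :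
    (opsYOfRecordDE N θ Mstar 𝔯 𝔈 x).QG1Qinv =
      siteKernelOfOp x.toKIdx (bg9Y (Matrix (Fin N) (Fin N) ℂ) (specialUnitaryUnits (Fin N)) x) (fun U => U)
        (fun U => Ring.inverse (QGQOfY x.toKIdx (parBY x.toKIdx)
          (G1Y x.toKIdx (parSY x.toKIdx) (parBY x.toKIdx) (GpY x.toKIdx (parSY x.toKIdx)) (𝔯 x).Δ2) U)) id id := rfl

/-- the knit's `(QGQ*)⁻¹` reading at the v3 record reads `U ↦ Ring.inverse ((QGQ*)(U))` over Sect. D's `G` (`rfl`).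
[cite: Balaban1985BackgroundPropagators, (3.132) p.422, (3.123) p.420, bookkeeping] -/
theorem opsYOfRecordDE_QGQinv (θ : Stage3Params) (Mstar : ℕ) (𝔯 : ResY N θ Mstar) (𝔈 : ExpsY N θ Mstar)
    (x : MemberY θ.d₆ θ.ℓ₆ θ.hd' θ.hL' θ.b₀ θ.b₁ Mstar) :
    (opsYOfRecordDE N θ Mstar 𝔯 𝔈 x).QGQinv =
      siteKernelOfOp x.toKIdx (bg9Y (Matrix (Fin N) (Fin N) ℂ) (specialUnitaryUnits (Fin N)) x) (fun U => U)
        (fun U => Ring.inverse (QGQY x.toKIdx (parSY x.toKIdx) (parBY x.toKIdx) (GpY x.toKIdx (parSY x.toKIdx)) U)) id id := rfl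

/-- ★★ **ROW 26 OF THE N06 KNIT AT def-Y's v3 RECORD `opsYOfRecordDE`, BOTH LETTERS GENUINE, FROM EXACTLY FOUR ESTIMATE BINDERS**: `s3132 :
B9.Stmt3132Printed d′ c35 geo9Y (bg9Y …) (x ↦ (ops x).QGQinv) (x ↦ (ops x).QG1Qinv)` at `ops := opsYOfRecordDE N θ M⋆ 𝔯 𝔈` follows from Thm 3.11-type
COERCIVITY and Thm 3.3-type DECAY (`B9Eq3132CTInputs.CoerciveUnder ∕ DecayUnder`) of the normalised real matrices (symmetric weights `(Lʲη)^{−(1+d′∕2)}`, any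
real basis `b` of `M_N(ℂ)`) of the GENUINE `(QGQ*)(U)` over Sect. D's `G` (`hco`, `hdec`) and of the GENUINE `(QG₁Q*)(U)` over `G₁ … (𝔯 x).Δ2` (`hco₁`,
`hdec₁`) — g5's `s3132_withSectD` at `𝔏 := lettersYResOfRecord … 𝔯` (def-Y's `lettersYOfRecordDE_eq_withSectD`, `rfl`) with the second half supplied by
g4's ring-inverse dictionary (`half3132_geo9Y_of_ringInverse`).  Honest: the four estimates are hypotheses for good in this programme (print: Sect. B's
analysis of `(Q′G′²Q′*)⁻¹` «in the same way», not typed); count-neutral; NOT a node discharge.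
[cite: Balaban1985BackgroundPropagators, (3.132) p.422 + Thm 3.12 p.423 (prefix), (3.122)–(3.123) p.420, (3.128)–(3.129) p.421; Balaban1984PropagatorsII, Lemma 2.1 (2.60)–(2.61) p.234] -/
theorem s3132_opsYOfRecordDE (θ : Stage3Params) (Mstar : ℕ) (𝔯 : ResY N θ Mstar) (𝔈 : ExpsY N θ Mstar) (dd : ℕ) {c35 : ℝ}
    [∀ x : MemberY θ.d₆ θ.ℓ₆ θ.hd' θ.hL' θ.b₀ θ.b₁ Mstar, Fintype (geo9Y x).Site]
    [∀ x : MemberY θ.d₆ θ.ℓ₆ θ.hd' θ.hL' θ.b₀ θ.b₁ Mstar, DecidableEq (geo9Y x).Site]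
    (b : Module.Basis Ff ℝ (Matrix (Fin N) (Fin N) ℂ))
    (hco : CoerciveUnder c35
      (fun x : MemberY θ.d₆ θ.ℓ₆ θ.hd' θ.hL' θ.b₀ θ.b₁ Mstar => geoComap (geo9Y x) (Prod.fst : (geo9Y x).Site × Ff → (geo9Y x).Site))
      (bg9Y (Matrix (Fin N) (Fin N) ℂ) (specialUnitaryUnits (Fin N)))
      (fun x U => normMatY b (fun y => (geo9Y x).len y ^ (-(1 + (dd : ℝ) / 2)))
        (QGQY x.toKIdx (parSY x.toKIdx) (parBY x.toKIdx) (GpY x.toKIdx (parSY x.toKIdx)) U)))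
    (hdec : DecayUnder c35
      (fun x : MemberY θ.d₆ θ.ℓ₆ θ.hd' θ.hL' θ.b₀ θ.b₁ Mstar => geoComap (geo9Y x) (Prod.fst : (geo9Y x).Site × Ff → (geo9Y x).Site))
      (bg9Y (Matrix (Fin N) (Fin N) ℂ) (specialUnitaryUnits (Fin N)))
      (fun x U => normMatY b (fun y => (geo9Y x).len y ^ (-(1 + (dd : ℝ) / 2)))
        (QGQY x.toKIdx (parSY x.toKIdx) (parBY x.toKIdx) (GpY x.toKIdx (parSY x.toKIdx)) U)))
    (hco₁ : CoerciveUnder c35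
      (fun x : MemberY θ.d₆ θ.ℓ₆ θ.hd' θ.hL' θ.b₀ θ.b₁ Mstar => geoComap (geo9Y x) (Prod.fst : (geo9Y x).Site × Ff → (geo9Y x).Site))
      (bg9Y (Matrix (Fin N) (Fin N) ℂ) (specialUnitaryUnits (Fin N)))
      (fun x U => normMatY b (fun y => (geo9Y x).len y ^ (-(1 + (dd : ℝ) / 2)))
        (QGQOfY x.toKIdx (parBY x.toKIdx)
          (G1Y x.toKIdx (parSY x.toKIdx) (parBY x.toKIdx) (GpY x.toKIdx (parSY x.toKIdx)) (𝔯 x).Δ2) U)))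
    (hdec₁ : DecayUnder c35
      (fun x : MemberY θ.d₆ θ.ℓ₆ θ.hd' θ.hL' θ.b₀ θ.b₁ Mstar => geoComap (geo9Y x) (Prod.fst : (geo9Y x).Site × Ff → (geo9Y x).Site))
      (bg9Y (Matrix (Fin N) (Fin N) ℂ) (specialUnitaryUnits (Fin N)))
      (fun x U => normMatY b (fun y => (geo9Y x).len y ^ (-(1 + (dd : ℝ) / 2)))
        (QGQOfY x.toKIdx (parBY x.toKIdx)
          (G1Y x.toKIdx (parSY x.toKIdx) (parBY x.toKIdx) (GpY x.toKIdx (parSY x.toKIdx)) (𝔯 x).Δ2) U))) :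
    B9.Stmt3132Printed dd c35 (geo9Y (d := θ.d₆) (ℓ := θ.ℓ₆) (hd := θ.hd') (hL := θ.hL') (b₀ := θ.b₀) (b₁ := θ.b₁) (Mstar := Mstar))
      (bg9Y (Matrix (Fin N) (Fin N) ℂ) (specialUnitaryUnits (Fin N)))
      (fun x => (opsYOfRecordDE N θ Mstar 𝔯 𝔈 x).QGQinv)
      (fun x => (opsYOfRecordDE N θ Mstar 𝔯 𝔈 x).QG1Qinv) := by
  have h₁ : Half3132 dd c35 (geo9Y (d := θ.d₆) (ℓ := θ.ℓ₆) (hd := θ.hd') (hL := θ.hL') (b₀ := θ.b₀) (b₁ := θ.b₁) (Mstar := Mstar))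
      (bg9Y (Matrix (Fin N) (Fin N) ℂ) (specialUnitaryUnits (Fin N)))
      (fun x => (opsYOfLetters N θ Mstar (fun x => withSectD (Matrix (Fin N) (Fin N) ℂ) (lettersYResOfRecord N θ Mstar 𝔯 x)) 𝔈 x).QG1Qinv) :=
    half3132_geo9Y_of_ringInverse (specialUnitaryUnits (Fin N)) b dd
      (fun x U => QGQOfY x.toKIdx (parBY x.toKIdx)
        (G1Y x.toKIdx (parSY x.toKIdx) (parBY x.toKIdx) (GpY x.toKIdx (parSY x.toKIdx)) (𝔯 x).Δ2) U) hco₁ hdec₁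
  exact s3132_withSectD θ Mstar (lettersYResOfRecord N θ Mstar 𝔯) 𝔈 dd b hco hdec h₁

end Row26

end

end Literature.MathematicalPhysics.QuantumFieldTheory.Balaban1983to89.B9Eq3132AtRecordDE
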